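import Summits.Parity.GeneralizedHardyLittlewood.Theorems.BeyondDiagonalBeatsQuarter.CornerReduction
import Summits.Parity.GeneralizedHardyLittlewood.Theorems.BeyondDiagonalBeatsQuarter.CornerAbel
import Summits.Parity.GeneralizedHardyLittlewood.Theorems.BeyondDiagonalBeatsQuarter.CornerMoebius
import Literature.NumberTheory.Sieve.VaughanMeanValueDecomposition
import HarnessLib

/-!
# Route `PrimeLevelFamEdge`, crux K_B (stmt-Parity-20343), line `diagonal_kernel_split`, helper H1
# (`CornerNegligibleXSq`), part 6: the corner at the `X²` profile as a weighted family of double sums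

With the KMV `X²` mollifier coefficients `x_a = xsq M a = μ(a)ψ(a)⁻¹(log(M/a)/log M)²` the
`τ`-decoupling of part 5 and the Selberg-coordinate identity `τ(k)x_{nk}/(nk) = W(n)·a_n(k)·ℓ_n(k)²/log²M`
(`tauR_mul_xsq_div`, `a_n = copTauW n`, `W = μ/(id·ψ)`) give
* `corner_eq_sum` — **`CORNER(M,Q) = Σ_{c≤M} Σ_{d≤M/c} μ(d)·c·W(cd)²/log⁴M · U(cd, d)`** with the double
  sums `U(n,d) = cornerU M Q n d = Σ_{k₁,k₂ ≤ M/n} a_n(k₁)a_n(k₂)ℓ⁺(k₁)²ℓ⁺(k₂)²E(d²k₁k₂/Q²)` of part 4;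
* `abs_cornerU_le` — the part-4 estimate fed with the part-3 bounds on the partial sums of `a_n`
  (`B = C·D(n)`, `η = C·D(n)/(1 + log K₁)¹²`) and `Σ_{k≤Y}|a_n(k)| ≤ Σ τ(k)/k ≤ (1 + log Y)²`:
  `|U(n,d)| ≤ D(n)·2log⁴(M/n)(1+log(M/n))²·(C′·d√(2K₁M)/Q + 2C(1+log K₁)⁻¹²(𝒲(1)+2+2|log(d/Q)|+2log M))`.
Helper toward the heart stub (plan Ω, H1); closes nothing; standard axioms.
«The programme SEARCHES and TYPES; no claim about Landau–Siegel zeros, Theorems 1–2 of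
arXiv:2211.02515 or a repaired Margin232 until a kernel theorem says so.»
-/

noncomputable section

open scoped Real ArithmeticFunction.Moebius
open Finset ArithmeticFunction

namespace Summit.Parity.GeneralizedHardyLittlewood.Theorems.BeyondDiagonalBeatsQuarter.Corner

open Literature.NumberTheory.LFunctions Literature.NumberTheory.LFunctions.KMV2000
open MollifierMainTerm (W)
open Literature.Barriers.Parity (Icc_one_eq_Ioc_zero)
open KernelFormXSq

/-! ### The double sums `U(n,d)` -/

/-- **`U(n,d) = Σ_{k₁,k₂ ≤ M/n} a_n(k₁)a_n(k₂)·ℓ⁺(k₁)²ℓ⁺(k₂)²·E(d²k₁k₂/Q²)`**, `a_n = copTauW n`,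
`ℓ⁺(k) = max(0, log((M/n)/k))`, `E = cornerE`: the decoupled double sums of the corner.
[cite: KowalskiMichelVanderKam2000, Prop. 5.1 — derivation (bookkeeping abbreviation)] -/
def cornerU (M Q : ℝ) (n d : ℕ) : ℝ :=
  ∑ k₁ ∈ Icc 1 ⌊M / n⌋₊, ∑ k₂ ∈ Icc 1 ⌊M / n⌋₊,
    copTauW n k₁ * copTauW n k₂ * ellp (M / n) k₁ ^ 2 * ellp (M / n) k₂ ^ 2 *
      cornerE ((d : ℝ) ^ 2 / Q ^ 2 * k₁ * k₂)

/-- `τ(k)·x_{nk}/(nk) = W(n)·a_n(k)·(log((M/n)/k)/log M)²` (`n, k ≥ 1`).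
[cite: KowalskiMichelVanderKam2000, (23) — derivation] -/
theorem tau_mul_xsq_div (M : ℝ) {n k : ℕ} (hn : n ≠ 0) (hk : k ≠ 0) :
    (k.divisors.card : ℝ) * (xsq M (n * k) / ((n * k : ℕ) : ℝ)) =
      W n * (copTauW n k * (Real.log (M / n / k) / Real.log M) ^ 2) := by
  have := tauR_mul_xsq_div M hn hk
  rwa [Nat.mul_div_cancel_left k (Nat.pos_of_ne_zero hn)] at this

/-- **The corner at the `X²` profile as a weighted family of double sums**: for `M ≥ 1`, `Q > 0`,
`Σ_{a,b ≤ M} x_a x_b (K_true(Q;a,b) − kmvKernel(log Q;a,b)) = Σ_{c ≤ M} Σ_{d ≤ M/c} μ(d)·c·W(cd)²/log⁴M·U(cd,d)`.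
[cite: KowalskiMichelVanderKam2000, (21)–(23), Prop. 5.1 — derivation (corner of the diagonal at P = X²)] -/
theorem corner_eq_sum {M Q : ℝ} (hM : 1 ≤ M) (hQ : 0 < Q) :
    ∑ a ∈ Icc 1 ⌊M⌋₊, ∑ b ∈ Icc 1 ⌊M⌋₊,
        xsq M a * xsq M b * (trueDiagKernel Q a b - kmvKernel (Real.log Q) a b) =
      ∑ c ∈ Icc 1 ⌊M⌋₊, ∑ d ∈ Icc 1 (⌊M⌋₊ / c),
        (μ d : ℝ) * c * W (c * d) ^ 2 / Real.log M ^ 4 * cornerU M Q (c * d) d := by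
  have hM0 : 0 ≤ M := by linarith
  have h1 : ∑ a ∈ Icc 1 ⌊M⌋₊, ∑ b ∈ Icc 1 ⌊M⌋₊,
      xsq M a * xsq M b * (trueDiagKernel Q a b - kmvKernel (Real.log Q) a b) =
      ∑ a ∈ Icc 1 ⌊M⌋₊, ∑ b ∈ Icc 1 ⌊M⌋₊, xsq M a * xsq M b * hKernel cornerE Q a b := by
    refine Finset.sum_congr rfl fun a ha ↦ Finset.sum_congr rfl fun b hb ↦ ?_
    have ha0 : a ≠ 0 := by have := (Finset.mem_Icc.1 ha).1; omega
    have hb0 : b ≠ 0 := by have := (Finset.mem_Icc.1 hb).1; omega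
    rw [trueDiagKernel_sub_kmvKernel hQ ha0 hb0]
  rw [h1, quadForm_hKernel_eq]
  refine Finset.sum_congr rfl fun c hc ↦ Finset.sum_congr rfl fun d hd ↦ ?_
  have hc0 : c ≠ 0 := by have := (Finset.mem_Icc.1 hc).1; omega
  have hd0 : d ≠ 0 := by have := (Finset.mem_Icc.1 hd).1; omega
  have hn0 : c * d ≠ 0 := mul_ne_zero hc0 hd0
  have hfloor : ⌊M⌋₊ / (c * d) = ⌊M / ((c * d : ℕ) : ℝ)⌋₊ := (Nat.floor_div_natCast M (c * d)).symm
  unfold cornerU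
  rw [hfloor, Finset.mul_sum, Finset.mul_sum]
  refine Finset.sum_congr rfl fun k₁ hk₁ ↦ ?_
  rw [Finset.mul_sum, Finset.mul_sum]
  refine Finset.sum_congr rfl fun k₂ hk₂ ↦ ?_
  have hk₁0 : k₁ ≠ 0 := by have := (Finset.mem_Icc.1 hk₁).1; omega
  have hk₂0 : k₂ ≠ 0 := by have := (Finset.mem_Icc.1 hk₂).1; omega
  rw [tau_mul_xsq_div M hn0 hk₁0, tau_mul_xsq_div M hn0 hk₂0]
  have hY : 0 ≤ M / ((c * d : ℕ) : ℝ) := by positivity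
  rw [ellp_eq_log hY hk₁, ellp_eq_log hY hk₂]
  have hE : cornerE ((d : ℝ) ^ 2 * k₁ * k₂ / Q ^ 2) = cornerE ((d : ℝ) ^ 2 / Q ^ 2 * k₁ * k₂) := by
    congr 1; ring
  rw [hE, div_pow, div_pow]
  ring

/-! ### The estimate for `U(n,d)` -/

/-- `Σ_{k ≤ Y} |a_n(k)|·ℓ⁺(k)² ≤ log²Y·(1 + log Y)²` (`|a_n(k)| ≤ τ(k)/k`, `Σ_{k≤Y} τ(k)/k ≤ (1+log Y)²`).
[folklore] -/
theorem sum_abs_copTauW_mul_ellp_sq_le (n : ℕ) {Y : ℝ} (hY : 1 ≤ Y) :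
    ∑ k ∈ Icc 1 ⌊Y⌋₊, |copTauW n k| * ellp Y k ^ 2 ≤ Real.log Y ^ 2 * (1 + Real.log Y) ^ 2 := by
  have hY0 : 0 < Y := by linarith
  have hLY : 0 ≤ Real.log Y := Real.log_nonneg hY
  have h1 : ∀ k ∈ Icc 1 ⌊Y⌋₊, |copTauW n k| * ellp Y k ^ 2 ≤
      (k.divisors.card : ℝ) / k * Real.log Y ^ 2 := by
    intro k hk
    have hk1 := (Finset.mem_Icc.1 hk).1
    have habs : |copTauW n k| ≤ (k.divisors.card : ℝ) / k := by
      rw [copTauW_apply]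
      split_ifs
      · rw [abs_mul, abs_of_nonneg (by positivity : (0 : ℝ) ≤ k.divisors.card), div_eq_mul_inv]
        exact mul_le_mul_of_nonneg_left (abs_W_le k) (by positivity)
      · rw [abs_zero]; positivity
    have hl : ellp Y k ^ 2 ≤ Real.log Y ^ 2 :=
      pow_le_pow_left₀ (ellp_nonneg Y k) (ellp_le_log hY hk1) 2
    exact mul_le_mul habs hl (sq_nonneg _) (by positivity)
  refine (Finset.sum_le_sum h1).trans ?_
  rw [← Finset.sum_mul]
  have h2 : ∑ k ∈ Icc 1 ⌊Y⌋₊, (k.divisors.card : ℝ) / k ≤ (1 + Real.log ⌊Y⌋₊) ^ 2 := by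
    rw [Icc_one_eq_Ioc_zero]
    exact Literature.NumberTheory.Sieve.Vaughan.sum_card_divisors_div_le ⌊Y⌋₊
  have h3 : (1 + Real.log ⌊Y⌋₊) ^ 2 ≤ (1 + Real.log Y) ^ 2 := by
    have hf1 : (1 : ℝ) ≤ ⌊Y⌋₊ := by exact_mod_cast Nat.le_floor (by simpa using hY)
    have : Real.log (⌊Y⌋₊ : ℝ) ≤ Real.log Y := Real.log_le_log (by linarith) (Nat.floor_le hY0.le)
    have : 0 ≤ Real.log (⌊Y⌋₊ : ℝ) := Real.log_nonneg hf1
    nlinarith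
  calc (∑ k ∈ Icc 1 ⌊Y⌋₊, (k.divisors.card : ℝ) / k) * Real.log Y ^ 2
      ≤ (1 + Real.log Y) ^ 2 * Real.log Y ^ 2 :=
        mul_le_mul_of_nonneg_right (h2.trans h3) (sq_nonneg _)
    _ = Real.log Y ^ 2 * (1 + Real.log Y) ^ 2 := by ring

/-- **The estimate for the double sums.** There are absolute `C₁, C₂ > 0` such that for every `n ≥ 1`,
`d ≥ 1`, `Q > 0`, `M ≥ n` and every threshold `K₁ : ℕ`:
`|U(n,d)| ≤ D(n)·(log⁴Y(1+log Y)²)·(2C₁·d·√(2K₁M)/Q·… )` — precisely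
`|U(n,d)| ≤ D(n)·2log⁴Y(1+log Y)²·(C₁√(2(d/Q)²K₁Y) + 2C₂(1+log K₁)⁻¹²(𝒲(1)+2+|log((d/Q)²)|+2log Y))`,
`Y = M/n` (part 4 with `a = a_n`, `B = C₁D(n)`, `η = C₂D(n)(1+log K₁)⁻¹²` from part 3).
[cite: KowalskiMichelVanderKam2000, Prop. 5.1 — derivation (corner double sums)] -/
theorem abs_cornerU_le :
    ∃ C₁ C₂ : ℝ, 0 < C₁ ∧ 0 < C₂ ∧ ∀ (n : ℕ), n ≠ 0 → ∀ (d : ℕ), d ≠ 0 → ∀ (Q M : ℝ), 0 < Q →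
      (n : ℝ) ≤ M → ∀ K₁ : ℕ,
      |cornerU M Q n d| ≤ divWeight n *
        (2 * Real.log (M / n) ^ 4 * (1 + Real.log (M / n)) ^ 2) *
          (C₁ * Real.sqrt (2 * ((d : ℝ) ^ 2 / Q ^ 2) * K₁ * (M / n)) +
            2 * (C₂ / (1 + Real.log K₁) ^ 12) *
              (scriptW 1 + 2 + |Real.log ((d : ℝ) ^ 2 / Q ^ 2)| + 2 * Real.log (M / n))) := by
  obtain ⟨C₁, hC₁, hB⟩ := abs_sum_copTauW_le'
  obtain ⟨C₂, hC₂, hA⟩ := abs_sum_copTauW_le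
  refine ⟨C₁, C₂, hC₁, hC₂, fun n hn d hd Q M hQ hnM K₁ ↦ ?_⟩
  have hn0 : (0 : ℝ) < n := by exact_mod_cast Nat.pos_of_ne_zero hn
  set Y : ℝ := M / n with hYdef
  have hY : 1 ≤ Y := by rw [hYdef, le_div_iff₀ hn0]; linarith
  have hα : 0 < (d : ℝ) ^ 2 / Q ^ 2 := by
    have : (0 : ℝ) < d := by exact_mod_cast Nat.pos_of_ne_zero hd
    positivity
  have hD := divWeight_nonneg n
  -- partial-sum inputs
  have hBe : ∀ e : ℕ, |∑ k ∈ Icc 1 e, copTauW n k| ≤ C₁ * divWeight n := by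
    intro e
    rcases Nat.eq_zero_or_pos e with rfl | he
    · simp only [show Icc (1 : ℕ) 0 = ∅ from Finset.Icc_eq_empty (by norm_num), Finset.sum_empty,
        abs_zero]
      positivity
    · have := hB n hn (e : ℝ) (by exact_mod_cast he)
      rwa [Nat.floor_natCast] at this
  have hηe : ∀ e : ℕ, K₁ ≤ e → |∑ k ∈ Icc 1 e, copTauW n k| ≤ C₂ / (1 + Real.log K₁) ^ 12 * divWeight n := by
    intro e he
    rcases Nat.eq_zero_or_pos e with rfl | he0
    · simp only [show Icc (1 : ℕ) 0 = ∅ from Finset.Icc_eq_empty (by norm_num), Finset.sum_empty,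
        abs_zero]
      have : 0 ≤ Real.log (K₁ : ℝ) := Real.log_natCast_nonneg K₁
      positivity
    · have h := hA n hn (e : ℝ) (by exact_mod_cast he0)
      rw [Nat.floor_natCast] at h
      refine h.trans ?_
      have hK : 0 ≤ Real.log (K₁ : ℝ) := Real.log_natCast_nonneg K₁
      have hle : Real.log (K₁ : ℝ) ≤ Real.log (e : ℝ) := by
        rcases Nat.eq_zero_or_pos K₁ with rfl | hK0
        · simp only [Nat.cast_zero, Real.log_zero]; exact Real.log_natCast_nonneg e
        · exact Real.log_le_log (by exact_mod_cast hK0) (by exact_mod_cast he)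
      calc C₂ * divWeight n / (1 + Real.log (e : ℝ)) ^ 12
          = C₂ / (1 + Real.log (e : ℝ)) ^ 12 * divWeight n := by ring
        _ ≤ C₂ / (1 + Real.log (K₁ : ℝ)) ^ 12 * divWeight n := by
            apply mul_le_mul_of_nonneg_right _ hD
            apply div_le_div_of_nonneg_left hC₂.le (by positivity)
            exact pow_le_pow_left₀ (by positivity) (by linarith) 12
  have hmain := abs_doubleSum_cornerE_le (a := fun k ↦ copTauW n k) (K₁ := K₁) hY hα hBe hηe
  have hS := sum_abs_copTauW_mul_ellp_sq_le n hY
  unfold cornerU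
  rw [← hYdef]
  refine hmain.trans ?_
  have hLY : 0 ≤ Real.log Y := Real.log_nonneg hY
  have hW : 0 ≤ scriptW 1 := scriptW_nonneg zero_le_one
  have hpos : 0 ≤ C₁ * divWeight n * Real.sqrt (2 * ((d : ℝ) ^ 2 / Q ^ 2) * K₁ * Y) +
      2 * (C₂ / (1 + Real.log K₁) ^ 12 * divWeight n) *
        (scriptW 1 + 2 + |Real.log ((d : ℝ) ^ 2 / Q ^ 2)| + 2 * Real.log Y) := by
    have : 0 ≤ Real.log (K₁ : ℝ) := Real.log_natCast_nonneg K₁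
    positivity
  calc (∑ k ∈ Icc 1 ⌊Y⌋₊, |copTauW n k| * ellp Y k ^ 2) * (2 * Real.log Y ^ 2) *
        (C₁ * divWeight n * Real.sqrt (2 * ((d : ℝ) ^ 2 / Q ^ 2) * K₁ * Y) +
          2 * (C₂ / (1 + Real.log K₁) ^ 12 * divWeight n) *
            (scriptW 1 + 2 + |Real.log ((d : ℝ) ^ 2 / Q ^ 2)| + 2 * Real.log Y))
      ≤ (Real.log Y ^ 2 * (1 + Real.log Y) ^ 2) * (2 * Real.log Y ^ 2) *
        (C₁ * divWeight n * Real.sqrt (2 * ((d : ℝ) ^ 2 / Q ^ 2) * K₁ * Y) +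
          2 * (C₂ / (1 + Real.log K₁) ^ 12 * divWeight n) *
            (scriptW 1 + 2 + |Real.log ((d : ℝ) ^ 2 / Q ^ 2)| + 2 * Real.log Y)) := by
        apply mul_le_mul_of_nonneg_right _ hpos
        exact mul_le_mul_of_nonneg_right hS (by positivity)
    _ = divWeight n * (2 * Real.log Y ^ 4 * (1 + Real.log Y) ^ 2) *
        (C₁ * Real.sqrt (2 * ((d : ℝ) ^ 2 / Q ^ 2) * K₁ * Y) +
          2 * (C₂ / (1 + Real.log K₁) ^ 12) *
            (scriptW 1 + 2 + |Real.log ((d : ℝ) ^ 2 / Q ^ 2)| + 2 * Real.log Y)) := by ring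

end Summit.Parity.GeneralizedHardyLittlewood.Theorems.BeyondDiagonalBeatsQuarter.Corner
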